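import Summits.HodgeConjecture.HodgeConjecture.Theorems.R90S4SubquotientLattice   -- ★ p861995 (this seat) (c₁): subquotient lattice, second isomorphism, one graded piece
import Literature.NumberTheory.Automorphic.WhittakerTwistedJacquet              -- ★ `Representation.charTwist`, `IsSmooth.charTwist`, `coinvariantsMap_injective_of_isLimitOfCompactOpen` (BZ)
import Literature.NumberTheory.Automorphic.AdmissibleSubquotient                -- ★ `IsSmooth.toRepresentation`, `IsSmooth.of_surjective`
import HarnessLib

/-!
# R90-TF · S4 «Ch. 13.1–2» — (ORBIT)∕(SWAP) support, part (c₂): the SLOT LEMMA for twisted coinvariants —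
# two DISTINCT constituents of a smooth representation whose `(H, θ)`-coinvariants have dimension `≤ 1` are not both `(H, θ)`-generic

Cell `hodgecm-mathlib`, crux H413 (`stmt-HodgeConjecture-24833`, lane `--supports … --as helper`), route of record `HCCMUnconditional`
(no route verbs; count-neutral).  Programme R90-TF (brief `director/R90-BRIEF.v2.md` 1f40d54518340a35), section S4 = Rogawski Ch. 13.1–2
(base `R90-C131`); seat R90-C131-p01 (g0); hand «(c) SLOT LEMMA» (R90-C131-p03 (g0) 2026-09-04T16:27:47Z «p01 TAKE (c)(e)»; census
`R90/R90-C131-p01/g0/CENSUS-orbit.md` 62930f5ed58633f2) toward the Whittaker-model proof of (SWAP) = the outer-similitude swap of the two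
constituents of `i_{U(Φ₂)}(χ)`, `χ₁|F^× = ω` ([Rogawski1990, §11.1 p. 161]; Labesse–Langlands), i.e. socket S4#B5 `stub_R90_S4_H_lds` via ★
`Theorems/R90S4U2OuterSimilSwap` (p03) and ★ `Theorems/R90S4HLdsOfKeys` (p05).  THEOREMS ONLY (no `def`, no instance, no notation, no named
fact, no `sorry`); ★-only imports.

THE STATEMENT (`not_nontrivial_coinvariants_charTwist_of_ne`).  `G` a topological group, `H ≤ G` a subgroup which is the union of its compact
open subgroups (★ `IsLimitOfCompactOpen`), `θ : H →* ℂˣ` with open kernel, `ρ` a SMOOTH representation of `G` whose `θ`-twisted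
`H`-coinvariants `J_{H,θ}(ρ) = V ⁄ V(H, θ)` (Mathlib `Coinvariants` of ★ `ρ.charTwist H θ`, [BernsteinZelevinskyASENS1977, §1.8 (b)]) are
finite-dimensional of dimension `≤ 1`.  If `c₁ ≠ c₂` are two constituents of `ρ` (★ `IrrClass.IsConstituentOf`) and `J_{H,θ}` of (a
representative of) `c₁` is non-zero, then `J_{H,θ}` of `c₂` is zero.  For `H = N` the unipotent radical of a Borel of `U(1,1)` and `θ = ψ`
a non-trivial character this is «at most one of `π⁺, π⁻` is `ψ`-generic» — step (c) of the census road.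

PROOF.  `dim J` is ADDITIVE on chains of subrepresentations (§2: right exactness is formal, left exactness is Bernstein–Zelevinsky's
★ `coinvariantsMap_injective_of_isLimitOfCompactOpen`, [BernsteinZelevinskyASENS1977, Prop. 1.9 (a)]) and bounded by `dim J(ρ) ≤ 1`
on every subrepresentation; `c₁ ≅ N₁ ⁄ N₂` contributes `1` on the step `[N₂, N₁]`; by ★ (c₁) `exists_step_of_isIrreducible_subquotient` ∕
`exists_subquotient_equiv_between` the irreducible `c₂ ≅ M₁ ⁄ M₂` is equivalent to a subquotient `A ⁄ B` inside ONE of the steps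
`[⊥, N₂]`, `[N₂, N₁]`, `[N₁, ⊤]`; in the outer steps additivity gives `dim J ≥ 2`; in the middle step the simplicity of `[N₂, N₁]`
(★ `eq_or_eq_of_isIrreducible_subquotient`) forces `A ⁄ B = N₁ ⁄ N₂`, i.e. `c₂ = c₁`.

CONTENTS. §1 coinvariants along equivalences and along `charTwist` (transport of `dim` and of non-triviality) · §2 the quotient formula
`dim J(σ) = dim (image of P) + dim J(σ ⁄ P)` and ADDITIVITY `dim J(A) = dim J(B) + dim J(A ⁄ B)` for subrepresentations `B ≤ A` of a smooth `ρ`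
(all `J`'s finite as soon as `J(ρ)` is) · §3 the slot lemma.

HONEST LABEL: HC_CM is proved only modulo the 7 printed citations (2 remaining named inputs: hLiu418 = stmt-HodgeConjecture-24832,
h413 = stmt-HodgeConjecture-24833) until rung 0 closes; this file is representation-theoretic plumbing and discharges none of them.  REL ≠ ★ ≠ BUILT.

## References
[BernsteinZelevinskyASENS1977] I. N. Bernstein, A. V. Zelevinsky, *Induced representations of reductive p-adic groups I*, Ann. Sci. ÉNS 10 (1977),
§1.8 (b), Prop. 1.9 (a), §2 · [Bump1997] D. Bump, *Automorphic Forms and Representations* (1997), §4.4 pp. 460–465 (`V_{N,ψ}`, `J_ψ`, exactness) ·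
[Rogawski1990] J. D. Rogawski, *Automorphic Representations of Unitary Groups in Three Variables* (1990), §11.1 p. 161, §12.1 p. 171.
-/

set_option autoImplicit false
-- the mandated namespace (brief §3.4) repeats the single-problem summit's segment (`HodgeConjecture.HodgeConjecture`)
set_option linter.dupNamespace false

namespace Summit.HodgeConjecture.HodgeConjecture.R90.S4

open Representation Literature.NumberTheory.Automorphic

universe u

/-! ## §1 Coinvariants along equivalences; `charTwist` along equivalences -/

section Coinv

variable {k : Type*} [Field k] {Γ : Type*} [Group Γ] {W W' : Type*} [AddCommGroup W] [Module k W]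
  [AddCommGroup W'] [Module k W'] {σ : Representation k Γ W} {σ' : Representation k Γ W'}

/-- A surjective intertwining map induces a surjection on coinvariants (right exactness, formal). [cite: BernsteinZelevinskyASENS1977, §1.8 (b)] -/
theorem coinvariants_map_surjective (f : σ.IntertwiningMap σ') (hf : Function.Surjective f) :
    Function.Surjective (Coinvariants.map σ σ' f) := by
  intro y
  obtain ⟨w', rfl⟩ := Coinvariants.mk_surjective σ' y
  obtain ⟨w, rfl⟩ := hf w'
  exact ⟨Coinvariants.mk σ w, Coinvariants.map_mk f w⟩

/-- **Coinvariants along an equivalence of representations**: `J(σ) ≃ J(σ′)`. [cite: BernsteinZelevinskyASENS1977, §1.8 (b)] -/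
theorem nonempty_coinvariants_linearEquiv (e : σ.Equiv σ') : Nonempty (σ.Coinvariants ≃ₗ[k] σ'.Coinvariants) := by
  refine ⟨LinearEquiv.ofBijective (Coinvariants.map σ σ' e.toIntertwiningMap) ⟨?_, ?_⟩⟩
  · -- injective: `map e⁻¹ ∘ map e = id`
    have hcomp : e.symm.toIntertwiningMap.comp e.toIntertwiningMap = IntertwiningMap.id σ := by
      refine IntertwiningMap.ext (LinearMap.ext fun v => ?_)
      change e.symm.toIntertwiningMap (e.toIntertwiningMap v) = v
      exact e.symm_apply_apply v
    have hid : Coinvariants.map σ' σ e.symm.toIntertwiningMap ∘ₗ Coinvariants.map σ σ' e.toIntertwiningMap = LinearMap.id := by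
      rw [Coinvariants.map_comp, hcomp, Coinvariants.map_id]
    intro x y hxy
    have := congrArg (Coinvariants.map σ' σ e.symm.toIntertwiningMap) hxy
    rwa [← LinearMap.comp_apply, ← LinearMap.comp_apply, hid, LinearMap.id_apply, LinearMap.id_apply] at this
  · exact coinvariants_map_surjective e.toIntertwiningMap fun w' => ⟨e.symm w', e.apply_symm_apply w'⟩

/-- `dim J(σ) = dim J(σ′)` for equivalent `σ ≃ σ′`. [cite: BernsteinZelevinskyASENS1977, §1.8 (b)] -/
theorem finrank_coinvariants_eq_of_equiv (e : σ.Equiv σ') :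
    Module.finrank k σ.Coinvariants = Module.finrank k σ'.Coinvariants := by
  obtain ⟨L⟩ := nonempty_coinvariants_linearEquiv e
  exact L.finrank_eq

/-- `J(σ′)` is finite-dimensional if `J(σ)` is, for `σ ≃ σ′`. [cite: BernsteinZelevinskyASENS1977, §1.8 (b)] -/
theorem module_finite_coinvariants_of_equiv (e : σ.Equiv σ') [Module.Finite k σ.Coinvariants] :
    Module.Finite k σ'.Coinvariants := by
  obtain ⟨L⟩ := nonempty_coinvariants_linearEquiv e
  exact Module.Finite.equiv L

/-- `J(σ′)` is non-zero if `J(σ)` is, for `σ ≃ σ′`. [cite: BernsteinZelevinskyASENS1977, §1.8 (b)] -/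
theorem nontrivial_coinvariants_of_equiv (e : σ.Equiv σ') [Nontrivial σ.Coinvariants] : Nontrivial σ'.Coinvariants := by
  obtain ⟨L⟩ := nonempty_coinvariants_linearEquiv e
  exact L.injective.nontrivial

end Coinv

section CharTwist

variable {k : Type*} [Field k] {G : Type u} [Group G] {W W' : Type*} [AddCommGroup W] [Module k W]
  [AddCommGroup W'] [Module k W'] {σ : Representation k G W} {σ' : Representation k G W'}
  (H : Subgroup G) (θ : ↥H →* kˣ)

/-- **`charTwist` is functorial in equivalences**: `σ ≃ σ′` gives `(σ|_H ⊗ θ⁻¹) ≃ (σ′|_H ⊗ θ⁻¹)` (the same linear isomorphism).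
[cite: BernsteinZelevinskyASENS1977, §1.8 (b)] -/
theorem nonempty_charTwist_equiv (e : σ.Equiv σ') : Nonempty ((σ.charTwist H θ).Equiv (σ'.charTwist H θ)) := by
  refine ⟨Representation.Equiv.mk e.toLinearEquiv fun h => ?_⟩
  change e.toLinearEquiv.toLinearMap ∘ₗ ((((θ⁻¹ h : kˣ) : k)) • σ (h : G)) =
    ((((θ⁻¹ h : kˣ) : k)) • σ' (h : G)) ∘ₗ e.toLinearEquiv.toLinearMap
  rw [LinearMap.comp_smul, LinearMap.smul_comp]
  exact congrArg _ (e.isIntertwining' (h : G))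

/-- A quotient of a `charTwist` IS the `charTwist` of the quotient (same operators `[w] ↦ [θ(h)⁻¹ σ(h) w]`): for a `σ`-stable `P`,
`(σ ⁄ P)|_H ⊗ θ⁻¹ = (σ|_H ⊗ θ⁻¹) ⁄ P` as representations of `H` on `W ⁄ P`. [cite: BernsteinZelevinskyASENS1977, §1.8 (b)] -/
theorem charTwist_quotient_eq (P : Submodule k W) (hP : ∀ g : G, P ≤ P.comap (σ g)) :
    (σ.quotient P hP).charTwist H θ =
      (σ.charTwist H θ).quotient P (fun h _ hx => P.smul_mem _ (hP (h : G) hx)) := by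
  refine MonoidHom.ext fun h => LinearMap.ext fun q => ?_
  induction q using Submodule.Quotient.induction_on with
  | H w => rfl

end CharTwist

/-! ## §2 The quotient formula and additivity of `dim J` on chains of subrepresentations -/

section Additive

variable {k : Type*} [Field k] [CharZero k] {Γ : Type*} [Group Γ] [TopologicalSpace Γ] [IsTopologicalGroup Γ]
  {W : Type*} [AddCommGroup W] [Module k W] {σ : Representation k Γ W}

omit [CharZero k] [TopologicalSpace Γ] [IsTopologicalGroup Γ] in
/-- **Quotient formula**: for a `σ`-stable `P ≤ W`, the map `J(σ) → J(σ ⁄ P)` is onto with kernel the image of `P`, so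
`dim J(σ) = dim (P · J(σ)) + dim J(σ ⁄ P)` and `J(σ ⁄ P)` is finite-dimensional when `J(σ)` is.  (Right exactness only; no topology.)
[cite: BernsteinZelevinskyASENS1977, §1.8 (b)] [cite: Bump1997, §4.4 p. 462] -/
theorem finrank_coinvariants_eq_finrank_map_add_finrank_quotient (P : Submodule k W) (hP : ∀ g : Γ, P ≤ P.comap (σ g))
    [Module.Finite k σ.Coinvariants] :
    Module.Finite k (σ.quotient P hP).Coinvariants ∧
      Module.finrank k σ.Coinvariants =
        Module.finrank k ↥(P.map (Coinvariants.mk σ)) + Module.finrank k (σ.quotient P hP).Coinvariants := by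
  -- the quotient map as an intertwining map and the induced map on coinvariants
  let q : σ.IntertwiningMap (σ.quotient P hP) := { toLinearMap := P.mkQ, isIntertwining' := fun _ => rfl }
  let f := Coinvariants.map σ (σ.quotient P hP) q
  have hqs : Function.Surjective q := Submodule.Quotient.mk_surjective P
  have hfs : Function.Surjective f := coinvariants_map_surjective q hqs
  -- the kernel of `f` is the image of `P`
  have hker : LinearMap.ker f = P.map (Coinvariants.mk σ) := by
    refine le_antisymm ?_ ?_
    · intro x hx
      obtain ⟨w, rfl⟩ := Coinvariants.mk_surjective σ x
      rw [LinearMap.mem_ker] at hx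
      change Coinvariants.mk (σ.quotient P hP) (P.mkQ w) = 0 at hx
      rw [Coinvariants.mk_eq_zero] at hx
      -- `ker (σ ⁄ P) ≤ (ker σ).map P.mkQ`
      have hle : Coinvariants.ker (σ.quotient P hP) ≤ (Coinvariants.ker σ).map P.mkQ := by
        refine Submodule.span_le.2 ?_
        rintro _ ⟨⟨g, y⟩, rfl⟩
        induction y using Submodule.Quotient.induction_on with
        | H v =>
          refine ⟨σ g v - v, Coinvariants.sub_mem_ker g v, ?_⟩
          rw [map_sub]
          rfl
      obtain ⟨u, hu, huw⟩ := hle hx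
      have hwu : w - u ∈ P := by
        rw [← Submodule.Quotient.eq P]
        exact (huw.symm : P.mkQ w = P.mkQ u)
      have hsplit : Coinvariants.mk σ w = Coinvariants.mk σ (w - u) + Coinvariants.mk σ u := by
        rw [← map_add, sub_add_cancel]
      rw [hsplit, (Coinvariants.mk_eq_zero σ).2 hu, add_zero]
      exact Submodule.mem_map_of_mem hwu
    · rintro _ ⟨p, hp, rfl⟩
      rw [LinearMap.mem_ker]
      change Coinvariants.mk (σ.quotient P hP) (P.mkQ p) = 0
      rw [Submodule.mkQ_apply, (Submodule.Quotient.mk_eq_zero P).2 hp, map_zero]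
  have hfin : Module.Finite k (σ.quotient P hP).Coinvariants := Module.Finite.of_surjective f hfs
  refine ⟨hfin, ?_⟩
  have h := LinearMap.finrank_range_add_finrank_ker f
  rw [LinearMap.range_eq_top.2 hfs, finrank_top, hker] at h
  omega

/-- **Additivity on a step `B ≤ A`** of subrepresentations of a SMOOTH `σ` (`Γ` the union of its compact open subgroups, `char k = 0`):
`J(B) ↪ J(A)` (Bernstein–Zelevinsky left exactness, ★ `coinvariantsMap_injective_of_isLimitOfCompactOpen`) with image `B · J(A)`, whence
`dim J(A) = dim J(B) + dim J(A ⁄ B)`, all three finite when `J(A)` is. [cite: BernsteinZelevinskyASENS1977, Prop. 1.9 (a)] [cite: Bump1997, §4.4 pp. 462–465] -/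
theorem finrank_coinvariants_toRepresentation_add (hΓ : IsLimitOfCompactOpen Γ) (hσ : σ.IsSmooth)
    {A B : Subrepresentation σ} (hBA : B ≤ A) [Module.Finite k A.toRepresentation.Coinvariants] :
    Module.Finite k B.toRepresentation.Coinvariants ∧
    Module.Finite k (A.toRepresentation.quotient (B.toSubmodule.comap A.toSubmodule.subtype)
      fun g _ hx ↦ B.apply_mem_toSubmodule g hx).Coinvariants ∧
    Module.finrank k A.toRepresentation.Coinvariants =
      Module.finrank k B.toRepresentation.Coinvariants +
        Module.finrank k (A.toRepresentation.quotient (B.toSubmodule.comap A.toSubmodule.subtype)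
          fun g _ hx ↦ B.apply_mem_toSubmodule g hx).Coinvariants := by
  -- the inclusion `B ↪ A` as an intertwining map; it is injective, hence so is the map on coinvariants (BZ)
  let ι : B.toRepresentation.IntertwiningMap A.toRepresentation :=
    { toLinearMap := Submodule.inclusion hBA, isIntertwining' := fun _ => rfl }
  have hι : Function.Injective ι := Submodule.inclusion_injective hBA
  have hinj := coinvariantsMap_injective_of_isLimitOfCompactOpen hΓ (hσ.toRepresentation A) ι hι
  -- its range on coinvariants is the image of `P := B ∩ A ≤ A`
  have hrange : LinearMap.range (Coinvariants.map _ _ ι) = (B.toSubmodule.comap A.toSubmodule.subtype).map (Coinvariants.mk A.toRepresentation) := by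
    have h1 : LinearMap.range (Coinvariants.map _ _ ι) = (LinearMap.range ι.toLinearMap).map (Coinvariants.mk A.toRepresentation) := by
      have htop : (⊤ : Submodule k B.toRepresentation.Coinvariants) =
          (⊤ : Submodule k ↥B.toSubmodule).map (Coinvariants.mk B.toRepresentation) := by
        rw [Submodule.map_top, LinearMap.range_eq_top.2 (Coinvariants.mk_surjective _)]
      rw [LinearMap.range_eq_map, htop, ← Submodule.map_comp, Coinvariants.map_comp_mk, Submodule.map_comp, Submodule.map_top]
      rfl
    rw [h1]
    congr 1
    exact Submodule.range_inclusion _ _ hBA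
  obtain ⟨hfinQ, hsum⟩ := finrank_coinvariants_eq_finrank_map_add_finrank_quotient (σ := A.toRepresentation)
    (B.toSubmodule.comap A.toSubmodule.subtype) (fun g _ hx ↦ B.apply_mem_toSubmodule g hx)
  have hfinB : Module.Finite k B.toRepresentation.Coinvariants := Module.Finite.of_injective _ hinj
  refine ⟨hfinB, hfinQ, ?_⟩
  rw [hsum, ← hrange, LinearMap.finrank_range_of_inj hinj]

/-- **`dim J(A) ≤ dim J(σ)`** (and `J(A)` finite) for every subrepresentation `A` of a smooth `σ` with `J(σ)` finite-dimensional.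
[cite: BernsteinZelevinskyASENS1977, Prop. 1.9 (a)] -/
theorem finrank_coinvariants_toRepresentation_le (hΓ : IsLimitOfCompactOpen Γ) (hσ : σ.IsSmooth) (A : Subrepresentation σ)
    [Module.Finite k σ.Coinvariants] :
    Module.Finite k A.toRepresentation.Coinvariants ∧
      Module.finrank k A.toRepresentation.Coinvariants ≤ Module.finrank k σ.Coinvariants := by
  let ι : A.toRepresentation.IntertwiningMap σ := { toLinearMap := A.toSubmodule.subtype, isIntertwining' := fun _ => rfl }
  have hinj := coinvariantsMap_injective_of_isLimitOfCompactOpen hΓ hσ ι (Subtype.val_injective)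
  refine ⟨Module.Finite.of_injective _ hinj, ?_⟩
  rw [← LinearMap.finrank_range_of_inj hinj]
  exact Submodule.finrank_le _

end Additive

/-! ## §3 The slot lemma -/

section Slot

variable {G : Type u} [Group G] [TopologicalSpace G] [IsTopologicalGroup G] {V : Type*} [AddCommGroup V] [Module ℂ V]
  {ρ : Representation ℂ G V} (H : Subgroup G) (θ : ↥H →* ℂˣ)

/-- The `H`-subrepresentation of `ρ|_H ⊗ θ⁻¹` on the submodule of a `G`-subrepresentation `A` IS `(A.toRepresentation)|_H ⊗ θ⁻¹`
(same operators) — packaged as: for `G`-subrepresentations `B ≤ A` of `ρ`, the three `J`'s of `A`, `B`, `A ⁄ B` computed through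
`charTwist` obey additivity, all finite when `J(ρ|_H ⊗ θ⁻¹)` is, and `dim J(A) ≤ dim J(ρ)`. [cite: BernsteinZelevinskyASENS1977, Prop. 1.9 (a)] -/
theorem finrank_coinvariants_charTwist_add (hH : IsLimitOfCompactOpen ↥H) (hθ : IsOpen (θ.ker : Set ↥H)) (hρ : ρ.IsSmooth)
    [Module.Finite ℂ (ρ.charTwist H θ).Coinvariants] {A B : Subrepresentation ρ} (hBA : B ≤ A) :
    Module.Finite ℂ (A.toRepresentation.charTwist H θ).Coinvariants ∧
    Module.Finite ℂ (B.toRepresentation.charTwist H θ).Coinvariants ∧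
    Module.Finite ℂ ((A.toRepresentation.quotient (B.toSubmodule.comap A.toSubmodule.subtype)
      fun g _ hx ↦ B.apply_mem_toSubmodule g hx).charTwist H θ).Coinvariants ∧
    Module.finrank ℂ (A.toRepresentation.charTwist H θ).Coinvariants ≤ Module.finrank ℂ (ρ.charTwist H θ).Coinvariants ∧
    Module.finrank ℂ (A.toRepresentation.charTwist H θ).Coinvariants =
      Module.finrank ℂ (B.toRepresentation.charTwist H θ).Coinvariants +
        Module.finrank ℂ ((A.toRepresentation.quotient (B.toSubmodule.comap A.toSubmodule.subtype)
          fun g _ hx ↦ B.apply_mem_toSubmodule g hx).charTwist H θ).Coinvariants := by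
  -- `τ := ρ|_H ⊗ θ⁻¹` is smooth; its subrepresentations on `A`, `B`
  have hτ : (ρ.charTwist H θ).IsSmooth := hρ.charTwist H hθ
  let Aτ : Subrepresentation (ρ.charTwist H θ) :=
    { toSubmodule := A.toSubmodule
      apply_mem_toSubmodule := fun h _ hx => A.toSubmodule.smul_mem _ (A.apply_mem_toSubmodule (h : G) hx) }
  let Bτ : Subrepresentation (ρ.charTwist H θ) :=
    { toSubmodule := B.toSubmodule
      apply_mem_toSubmodule := fun h _ hx => B.toSubmodule.smul_mem _ (B.apply_mem_toSubmodule (h : G) hx) }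
  -- identifications (definitional): `Aτ.toRepresentation = A.toRepresentation|_H ⊗ θ⁻¹`, same for `B`, and the quotient (§1)
  have hA : Aτ.toRepresentation = A.toRepresentation.charTwist H θ := rfl
  have hB : Bτ.toRepresentation = B.toRepresentation.charTwist H θ := rfl
  have hQ : (A.toRepresentation.quotient (B.toSubmodule.comap A.toSubmodule.subtype)
      fun g _ hx ↦ B.apply_mem_toSubmodule g hx).charTwist H θ =
      Aτ.toRepresentation.quotient (Bτ.toSubmodule.comap Aτ.toSubmodule.subtype) fun g _ hx ↦ Bτ.apply_mem_toSubmodule g hx :=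
    charTwist_quotient_eq H θ _ _
  obtain ⟨hfinA, hleA⟩ := finrank_coinvariants_toRepresentation_le hH hτ Aτ
  haveI := hfinA
  obtain ⟨hfinB, hfinQ, hsum⟩ := finrank_coinvariants_toRepresentation_add hH hτ (A := Aτ) (B := Bτ) hBA
  rw [hQ]
  exact ⟨hfinA, hfinB, hfinQ, hleA, hsum⟩

omit [TopologicalSpace G] [IsTopologicalGroup G] in
/-- The twisted coinvariants of a constituent `c ≅ M₁ ⁄ M₂` are those of `(M₁ ⁄ M₂)|_H ⊗ θ⁻¹`: if `J` of a representative is non-zero,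
so is `J(M₁ ⁄ M₂)`, hence `1 ≤ dim J(M₁ ⁄ M₂)` once the latter is finite. [cite: BernsteinZelevinskyASENS1977, §1.8 (b)] -/
theorem one_le_finrank_coinvariants_subquotient_of_equiv {W : Type*} [AddCommGroup W] [Module ℂ W] {π : Representation ℂ G W}
    {M₁ M₂ : Subrepresentation ρ}
    (e : π.Equiv (M₁.toRepresentation.quotient (M₂.toSubmodule.comap M₁.toSubmodule.subtype) fun g _ hx ↦ M₂.apply_mem_toSubmodule g hx))
    [Nontrivial (π.charTwist H θ).Coinvariants]
    [Module.Finite ℂ ((M₁.toRepresentation.quotient (M₂.toSubmodule.comap M₁.toSubmodule.subtype)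
      fun g _ hx ↦ M₂.apply_mem_toSubmodule g hx).charTwist H θ).Coinvariants] :
    1 ≤ Module.finrank ℂ ((M₁.toRepresentation.quotient (M₂.toSubmodule.comap M₁.toSubmodule.subtype)
      fun g _ hx ↦ M₂.apply_mem_toSubmodule g hx).charTwist H θ).Coinvariants := by
  obtain ⟨e'⟩ := nonempty_charTwist_equiv H θ e
  haveI := nontrivial_coinvariants_of_equiv e'
  exact Module.finrank_pos

omit [TopologicalSpace G] [IsTopologicalGroup G] in
/-- `J(A ⁄ A) = 0`: a subquotient with equal ends has trivial coinvariants. [cite: BernsteinZelevinskyASENS1977, §1.8 (b)] -/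
theorem not_nontrivial_coinvariants_subquotient_self {A B : Subrepresentation ρ} (hAB : A = B) :
    ¬ Nontrivial ((A.toRepresentation.quotient (B.toSubmodule.comap A.toSubmodule.subtype)
      fun g _ hx ↦ B.apply_mem_toSubmodule g hx).charTwist H θ).Coinvariants := by
  subst hAB
  intro hnt
  obtain ⟨x, y, hxy⟩ := hnt
  apply hxy
  obtain ⟨qx, rfl⟩ := Coinvariants.mk_surjective _ x
  obtain ⟨qy, rfl⟩ := Coinvariants.mk_surjective _ y
  induction qx using Submodule.Quotient.induction_on with
  | H a =>
    induction qy using Submodule.Quotient.induction_on with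
    | H b =>
      have ha : (Submodule.Quotient.mk a : ↥A.toSubmodule ⧸ A.toSubmodule.comap A.toSubmodule.subtype) = 0 :=
        (Submodule.Quotient.mk_eq_zero _).2 a.2
      have hb : (Submodule.Quotient.mk b : ↥A.toSubmodule ⧸ A.toSubmodule.comap A.toSubmodule.subtype) = 0 :=
        (Submodule.Quotient.mk_eq_zero _).2 b.2
      rw [ha, hb]

/-- **SLOT LEMMA.**  Let `ρ` be a smooth representation of `G`, `H ≤ G` the union of its compact open subgroups, `θ : H →* ℂˣ` with open
kernel, and suppose the `θ`-twisted coinvariants `J(ρ) = V ⁄ V(H, θ)` are finite-dimensional with `dim J(ρ) ≤ 1`.  If `c₁ ≠ c₂ ∈ Irr(G)` are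
constituents of `ρ` (representatives `r₁`, `r₂`) and `J(r₁) ≠ 0`, then `J(r₂) = 0`.  («For each non-trivial `ψ`, at most one of the two
constituents `π⁺ ≠ π⁻` of `i(χ)` is `ψ`-generic, since `dim i(χ)_{N,ψ} ≤ 1` and `J_ψ` is exact.»)
[cite: BernsteinZelevinskyASENS1977, Prop. 1.9 (a), §2] [cite: Bump1997, §4.4 pp. 462–465] [cite: Rogawski1990, §11.1 p. 161] -/
theorem not_nontrivial_coinvariants_charTwist_of_ne (hH : IsLimitOfCompactOpen ↥H) (hθ : IsOpen (θ.ker : Set ↥H))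
    (hρ : ρ.IsSmooth) [Module.Finite ℂ (ρ.charTwist H θ).Coinvariants] (h1 : Module.finrank ℂ (ρ.charTwist H θ).Coinvariants ≤ 1)
    {r₁ r₂ : SmoothIrrep G} (hne : IrrClass.mk r₁ ≠ IrrClass.mk r₂)
    (h₁ : (IrrClass.mk r₁).IsConstituentOf ρ) (h₂ : (IrrClass.mk r₂).IsConstituentOf ρ)
    [Nontrivial (r₁.ρ.charTwist H θ).Coinvariants] : ¬ Nontrivial (r₂.ρ.charTwist H θ).Coinvariants := by
  intro hg₂
  -- `r₁ ≅ N₁ ⁄ N₂`, `r₂ ≅ M₁ ⁄ M₂`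
  obtain ⟨s₁, hs₁, N₁, N₂, hN, ⟨e₁⟩⟩ := h₁
  obtain ⟨s₂, hs₂, M₁, M₂, hM, ⟨e₂⟩⟩ := h₂
  obtain ⟨f₁⟩ := (IrrClass.mk_eq_mk_iff s₁ r₁).1 hs₁
  obtain ⟨f₂⟩ := (IrrClass.mk_eq_mk_iff s₂ r₂).1 hs₂
  have e₁' := f₁.symm.trans e₁   -- `r₁.ρ ≃ N₁ ⁄ N₂`
  have e₂' := f₂.symm.trans e₂   -- `r₂.ρ ≃ M₁ ⁄ M₂`
  haveI hirrN := e₁'.isIrreducible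
  haveI hirrM := e₂'.isIrreducible
  -- the step `[N₂, N₁]` carries `1`
  obtain ⟨hfinN₁, hfinN₂, hfinQN, hleN₁, hsumN⟩ := finrank_coinvariants_charTwist_add H θ hH hθ hρ hN
  haveI := hfinQN
  have hQN : 1 ≤ Module.finrank ℂ ((N₁.toRepresentation.quotient (N₂.toSubmodule.comap N₁.toSubmodule.subtype)
      fun g _ hx ↦ N₂.apply_mem_toSubmodule g hx).charTwist H θ).Coinvariants :=
    one_le_finrank_coinvariants_subquotient_of_equiv H θ e₁'
  -- the jump: `M₁ ⁄ M₂ ≅ A ⁄ B` inside one step `[L, U]`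
  have main : ∀ {L U : Subrepresentation ρ}, L ≤ U → L ⊓ M₁ ≤ M₂ → M₁ ≤ (U ⊓ M₁) ⊔ M₂ →
      ∃ A B : Subrepresentation ρ, L ≤ B ∧ B ≤ A ∧ A ≤ U ∧
        Nonempty (r₂.ρ.Equiv (A.toRepresentation.quotient (B.toSubmodule.comap A.toSubmodule.subtype)
          fun g _ hx ↦ B.apply_mem_toSubmodule g hx)) ∧
        1 ≤ Module.finrank ℂ ((A.toRepresentation.quotient (B.toSubmodule.comap A.toSubmodule.subtype)
          fun g _ hx ↦ B.apply_mem_toSubmodule g hx).charTwist H θ).Coinvariants := by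
    intro L U hLU hlow hhigh
    obtain ⟨hLB, hBA, hAU, ⟨φ⟩⟩ := exists_subquotient_equiv_between hLU hM hlow hhigh
    refine ⟨L ⊔ (U ⊓ M₁), L ⊔ (U ⊓ M₂), hLB, hBA, hAU, ⟨e₂'.trans φ⟩, ?_⟩
    obtain ⟨-, -, hfinQ, -, -⟩ := finrank_coinvariants_charTwist_add H θ hH hθ hρ hBA
    haveI := hfinQ
    haveI := hg₂
    exact one_le_finrank_coinvariants_subquotient_of_equiv H θ (e₂'.trans φ)
  rcases exists_step_of_isIrreducible_subquotient (N₁ := N₁) (N₂ := N₂) hM hirrM with ⟨hl, hh⟩ | ⟨hl, hh⟩ | ⟨hl, hh⟩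
  · -- step `[⊥, N₂]`: `dim J(N₁) ≥ 2`
    obtain ⟨A, B, -, hBA, hAN₂, -, hQ⟩ := main bot_le hl hh
    obtain ⟨-, -, -, -, hsum₂⟩ := finrank_coinvariants_charTwist_add H θ hH hθ hρ hAN₂
    obtain ⟨-, -, -, -, hsum₃⟩ := finrank_coinvariants_charTwist_add H θ hH hθ hρ hBA
    omega
  · -- step `[N₂, N₁]`: `A ⁄ B = N₁ ⁄ N₂`, so `c₂ = c₁`
    obtain ⟨A, B, hN₂B, hBA, hAN₁, ⟨ψ⟩, hQ⟩ := main hN hl hh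
    have hAB : A ≠ B := by
      intro hAB
      obtain ⟨-, -, hfinQ, -, -⟩ := finrank_coinvariants_charTwist_add H θ hH hθ hρ hBA
      haveI := hfinQ
      have hnt : Nontrivial ((A.toRepresentation.quotient (B.toSubmodule.comap A.toSubmodule.subtype)
          fun g _ hx ↦ B.apply_mem_toSubmodule g hx).charTwist H θ).Coinvariants :=
        Module.finrank_pos_iff.1 hQ
      exact not_nontrivial_coinvariants_subquotient_self H θ hAB hnt
    have hB : B = N₂ := by
      rcases eq_or_eq_of_isIrreducible_subquotient hirrN hN₂B (hBA.trans hAN₁) with h | h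
      · exact h
      · exact absurd (le_antisymm hAN₁ (h ▸ hBA)) (h ▸ hAB)
    have hA : A = N₁ := by
      rcases eq_or_eq_of_isIrreducible_subquotient hirrN (hN₂B.trans hBA) hAN₁ with h | h
      · exact absurd (le_antisymm (h ▸ hBA) hN₂B ▸ h) hAB
      · exact h
    obtain ⟨ξ⟩ := nonempty_subquotient_equiv_of_eq (ρ := ρ) hA hB
    exact hne (IrrClass.mk_eq_mk_of_equiv (e₁'.trans (ψ.trans ξ).symm))
  · -- step `[N₁, ⊤]`: `dim J(A) ≥ 2`
    obtain ⟨A, B, hN₁B, hBA, -, -, hQ⟩ := main le_top hl hh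
    obtain ⟨-, -, -, hleA, hsumA⟩ := finrank_coinvariants_charTwist_add H θ hH hθ hρ hBA
    obtain ⟨-, -, -, -, hsumB⟩ := finrank_coinvariants_charTwist_add H θ hH hθ hρ hN₁B
    omega

end Slot

end Summit.HodgeConjecture.HodgeConjecture.R90.S4
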